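import Summits.QuantumFields.YangMills.Theorems.IR.AfPincerUcSupplier
import Summits.QuantumFields.YangMills.Theorems.BalabanLadderIRTypLocalExcessRarity
import Summits.QuantumFields.YangMills.Theorems.BalabanLadderIRKernelEnergyGap
import HarnessLib

/-!
# Line `af-pincer-Uc` (crux `IR`, stmt-QuantumFields-19354), stub `stub_onsetUc`: the EXPLICIT any-exterior single-cell rarity
# budget of the working class `diluteTyp ∩ Typ_lx^int` — target (A′) discharged as a formula

Helper module for item `stmt-QuantumFields-19354` (`--supports`; it closes nothing); lead prover of the line.  Slot of record
«af-pincer-Uc» re-based on the tree format module (owner R81, sha16 7eb42365f8aba369; `stub_onsetUc :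
Summit.QuantumFields.YangMills.Cruxes.IR.AfPincerUc.OnsetMixingTypicalUKPc`).

WHAT IS HERE (all proved; no `sorry`; axioms ⊆ {propext, Classical.choice, Quot.sound}).
* §1 On an interior ball the relaxable links ARE a box: `ballLinks w c R x = boxEdges (x − R) (2R+1)`
  (`ballLinks_eq_boxEdges`), so `#ballLinks = 4(2R+1)⁴` and `#plaquettesTouching ballLinks ≤ 6(2R+2)⁴` (tree box counts).
* §2 The PER-BALL KERNEL BOUND, uniform in the exterior (infvol-p3's `IRKernelLargeField.kernel_apply_excess_le_of_subset`
  applied to the lead's `badBall ⊆ excessSet`): for `Λ ⊇ cellEdges w c`, every `ζ`, every interior `(R, x)`,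
  `γ_Λ(ζ)(badBall ρ w R E c x) ≤ ofReal (ballBudget N β r m R E)`,
  `ballBudget N β r m R E := exp(β · 4√N · r · 6(2R+2)⁴ − β E) / m ^ (4(2R+1)⁴)` for any Haar small-ball datum
  `ofReal m ≤ Haar{‖ρ g − 1‖ ≤ r}`, `m > 0`, `r ≥ 0` (`kernel_badBall_le`).
* §3 (A′) AS A FORMULA: `supCellRarityAt_workingClass_explicit` — on every mesh-`b` frame the working class
  `WorkingClass ρ ℓ T Rs E w` has `SupCellRarityAt` with budget
  `workingBudget := (2b)⁴ · exp(β(48 r² ℓ⁴ + 192 N ℓ³) − βT)/m^(4ℓ⁴) + (2b)⁴ · Σ_{R<b} ballBudget N β r m R (E R)`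
  (tree `supCellRarity_diluteTyp` + §2 + the lead's `supCellRarity_workingClass_of_ballBound`).  Honest price: the budget is
  `≤ δ` only if `βT` and `βE(R)` beat `log((2b)⁴/δ)` plus the entropy terms `4ℓ⁴ log(1/m)`, `4(2R+1)⁴ log(1/m)` — log β above
  equipartition at the Gaussian scale `r = β^{-1/2}`, `m = C₁ β^{−D/2}`.
(The reduction in the slot's own names — `ClauseIWorkingClassAtOnset → AfPincerUc.OnsetMixingTypicalUKPc` — is the sibling
`Theorems/IR/AfPincerUcOnsetReduction`, which must import the route-tied format module; this file is route-independent.)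

HONEST FRAMING: (a) is now an explicit energy–entropy formula; (b) — sub-region mixing of the Yang–Mills kernel at the centre
cell at a β-dependent mesh `b(β) → ∞` (bounded mesh refuted in kernel, `Theorems/IR/Negative/TypShellCondFalseFixedMesh`),
uniformly over typical frozen data — is the stub's research content (weak-coupling strong mixing of 4-d non-abelian lattice
gauge theory at scales beyond the correlation length) and is NOT claimed here or anywhere in the tree.  Conditional chain
above the crux untouched; not a gap, not Clay.
-/

set_option autoImplicit false

noncomputable section

open MeasureTheory
open scoped ENNReal Matrix.Norms.Frobenius
open Literature.MathematicalPhysics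
open Literature.MathematicalPhysics.QuantumFieldTheory Literature.MathematicalPhysics.QuantumLattice
open Literature.Probability.LatticeModels (Site)
open Summit.QuantumFields.YangMills.Cruxes.IR.Tempered (cellEdges regionEdges)
open Summit.QuantumFields.YangMills.Cruxes.IR.FixedMesh (ClauseI)
open Summit.QuantumFields.YangMills.Cruxes.IR.OnsetFormatsUc (IsFrame TypLocal)
open Summit.QuantumFields.YangMills.Theorems.OddTorusChessboard (cellSites mem_cellSites)
open Summit.QuantumFields.YangMills.Theorems.IRRarityUpgrade (regionEdges_singleton)
open Summit.QuantumFields.YangMills.Theorems.IRKernelLargeField (diluteTyp supCellRarity_diluteTyp boxSites boxEdges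
  mem_boxSites mem_boxEdges card_boxEdges card_plaquettesTouching_boxEdges_le excessSet kernel_apply_excess_le_of_subset)
open Summit.QuantumFields.YangMills.Theorems.IRTypLocalExcess (ballLinks ballLinks_subset_cellEdges IsInteriorBall LocalExcess
  TypLxInt WorkingClass frameCovariant_workingClass typLocal_workingClass badBall measurableSet_badBall
  badBall_subset_excessEvent supCellRarity_workingClass_of_ballBound)

namespace Summit.QuantumFields.YangMills.Cruxes.IR.AfPincerUc.Supplier

/-! ## §1 Interior balls are boxes -/

section Box

variable {w : Fin 4 → ℤ → ℤ} {c : Fin 4 → ℤ} {R : ℕ} {x : Site 4}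

/-- The links of the cell `c` are the links based at its sites (definitional). -/
theorem mem_cellEdges_iff (e : QuantumLattice.ZdEdge 4) : e ∈ cellEdges w c ↔ e.1 ∈ cellSites w c := by
  simp [Summit.QuantumFields.YangMills.Cruxes.IR.Tempered.cellEdges,
    Summit.QuantumFields.YangMills.Theorems.OddTorusChessboard.cellSites]

/-- **On an interior ball the relaxable links are exactly the links based in the box of side `2R+1` cornered at `x − R`.** -/
theorem ballLinks_eq_boxEdges (hint : IsInteriorBall w c R x) :
    ballLinks w c R x = boxEdges (fun i => x i - R) (2 * R + 1) := by
  ext e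
  rw [ballLinks, Finset.mem_filter, mem_boxEdges, mem_boxSites, mem_cellEdges_iff]
  constructor
  · rintro ⟨-, hball⟩ i
    have h := abs_le.1 (hball i)
    constructor <;> push_cast <;> omega
  · intro hbox
    have hball : ∀ i, |e.1 i - x i| ≤ (R : ℤ) := fun i => by
      have h := hbox i
      push_cast at h
      exact abs_le.2 ⟨by omega, by omega⟩
    exact ⟨hint e.1 fun i => (hball i).trans (by linarith), hball⟩

/-- `#ballLinks = 4(2R+1)⁴` on an interior ball. -/
theorem card_ballLinks_of_isInteriorBall (hint : IsInteriorBall w c R x) :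
    (ballLinks w c R x).card = 4 * (2 * R + 1) ^ 4 := by
  rw [ballLinks_eq_boxEdges hint, card_boxEdges]

/-- `#plaquettesTouching ballLinks ≤ 6(2R+2)⁴` on an interior ball. -/
theorem card_plaquettesTouching_ballLinks_le (hint : IsInteriorBall w c R x) :
    (plaquettesTouching (ballLinks w c R x)).card ≤ 6 * (2 * R + 2) ^ 4 := by
  rw [ballLinks_eq_boxEdges hint]
  exact card_plaquettesTouching_boxEdges_le _ _

end Box

/-! ## §2 The per-ball kernel bound, uniform in the exterior -/

section Ball

variable {G : Type} [Group G] [TopologicalSpace G] [IsTopologicalGroup G] [CompactSpace G]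
  [MeasurableSpace G] [BorelSpace G] [SecondCountableTopology G] [T2Space G]
  {N : ℕ} (ρ : G →* Matrix (Fin N) (Fin N) ℂ)

/-- **The per-ball budget** at Haar small-ball datum `(r, m)`: `exp(β · 4√N · r · 6(2R+2)⁴ − β E) / m ^ (4(2R+1)⁴)`. -/
def ballBudget (N : ℕ) (β r m : ℝ) (R : ℕ) (E : ℝ) : ℝ :=
  Real.exp (β * (4 * Real.sqrt N * r * (6 * (2 * (R : ℝ) + 2) ^ 4)) - β * E) / m ^ (4 * (2 * R + 1) ^ 4)

omit [TopologicalSpace G] [IsTopologicalGroup G] [CompactSpace G] [MeasurableSpace G] [BorelSpace G]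
  [SecondCountableTopology G] [T2Space G] in
/-- The per-ball budget is non-negative for `m > 0`. -/
theorem ballBudget_nonneg (N : ℕ) (β r : ℝ) {m : ℝ} (hm : 0 < m) (R : ℕ) (E : ℝ) : 0 ≤ ballBudget N β r m R E :=
  div_nonneg (Real.exp_pos _).le (pow_pos hm _).le

/-- **Per-ball kernel bound, uniform in the exterior.**  For an interior ball `(R, x)` of cell `c`, any finite `Λ ⊇ cellEdges
w c`, EVERY exterior `ζ`, `β ≥ 0` and any Haar small-ball datum `ofReal m ≤ Haar{‖ρ g − 1‖ ≤ r}` (`m > 0`, `r ≥ 0`):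
`γ_Λ(ζ)(badBall ρ w R E c x) ≤ ofReal (ballBudget N β r m R E)` — infvol-p3's energy-gap kernel bound on the lead's bad
event (`badBall ⊆ excessSet (ballLinks …)` on interior balls, `dirichletAction_eq_wilsonBoundaryAction`). -/
theorem kernel_badBall_le (hρ : Continuous ρ) (hU : ∀ g, ρ g ∈ Matrix.unitaryGroup (Fin N) ℂ) {β : ℝ} (hβ : 0 ≤ β)
    {w : Fin 4 → ℤ → ℤ} {c : Fin 4 → ℤ} {R : ℕ} {x : Site 4} (hint : IsInteriorBall w c R x)
    {Λ : Finset (QuantumLattice.ZdEdge 4)} (hΛ : cellEdges w c ⊆ Λ) (ζ : LGConfig 4 G) (E : ℝ)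
    {r m : ℝ} (hr : 0 ≤ r) (hm : 0 < m) (hball : ENNReal.ofReal m ≤ haarProbability G {g : G | ‖ρ g - 1‖ ≤ r}) :
    ymSpecification ρ β Λ ζ (badBall ρ w R E c x) ≤ ENNReal.ofReal (ballBudget N β r m R E) := by
  have hsub : badBall ρ w R E c x ⊆ excessSet ρ (ballLinks w c R x) E := fun U hU => by
    obtain ⟨V, hV, h⟩ := badBall_subset_excessEvent ρ hint E hU
    exact ⟨V, hV, h⟩
  have hEΛ : ballLinks w c R x ⊆ Λ := (ballLinks_subset_cellEdges w c R x).trans hΛ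
  refine (kernel_apply_excess_le_of_subset ρ hρ hU hβ hEΛ ζ (measurableSet_badBall ρ hρ w R E c x) hsub hr hm
    hball).trans (ENNReal.ofReal_le_ofReal ?_)
  rw [ballBudget, card_ballLinks_of_isInteriorBall hint]
  refine div_le_div_of_nonneg_right ?_ (pow_pos hm _).le
  rw [Real.exp_le_exp]
  have hcard : ((plaquettesTouching (ballLinks w c R x)).card : ℝ) ≤ 6 * (2 * (R : ℝ) + 2) ^ 4 := by
    exact_mod_cast card_plaquettesTouching_ballLinks_le hint
  have h4 : 0 ≤ 4 * Real.sqrt N * r := by positivity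
  nlinarith [mul_le_mul_of_nonneg_left hcard h4]

end Ball

/-! ## §3 (A′) as a formula: the any-exterior single-cell rarity budget of the working class -/

section Working

variable {G : Type} [Group G] [TopologicalSpace G] [IsTopologicalGroup G] [CompactSpace G]
  [MeasurableSpace G] [BorelSpace G] [SecondCountableTopology G] [T2Space G]
  {N : ℕ} (ρ : G →* Matrix (Fin N) (Fin N) ℂ)

/-- **The working-class budget** on mesh `b` at parameters `(ℓ, T, E)` and Haar small-ball datum `(r, m)`:
dilute tier `(2b)⁴ · exp(β(48 r² ℓ⁴ + 192 N ℓ³) − βT)/m^(4ℓ⁴)` plus local-excess tier `(2b)⁴ · Σ_{R<b} ballBudget`. -/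
def workingBudget (N : ℕ) (β r m : ℝ) (b ℓ : ℕ) (T : ℝ) (E : ℕ → ℝ) : ℝ :=
  (2 * b : ℝ) ^ 4 * (Real.exp (β * (48 * r ^ 2 * (ℓ : ℝ) ^ 4 + 192 * N * (ℓ : ℝ) ^ 3) - β * T) / m ^ (4 * ℓ ^ 4)) +
    (2 * b : ℝ) ^ 4 * ∑ R ∈ Finset.range b, ballBudget N β r m R (E R)

/-- **(A′) DISCHARGED AS A FORMULA: any-exterior single-cell rarity of the working class.**  On every mesh-`b` frame, for
`β ≥ 0`, `ℓ ≥ 1`, any scale set `Rs`, thresholds `T`, `E`, and any Haar small-ball datum `(r, m)`: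
`SupCellRarityAt ρ β w (WorkingClass ρ ℓ T Rs E w) (workingBudget N β r m b ℓ T E)`. -/
theorem supCellRarityAt_workingClass_explicit (hρ : Continuous ρ) (hU : ∀ g, ρ g ∈ Matrix.unitaryGroup (Fin N) ℂ)
    {β : ℝ} (hβ : 0 ≤ β) {b : ℕ} {w : Fin 4 → ℤ → ℤ} (hw : IsFrame b w) {ℓ : ℕ} (hℓ : 1 ≤ ℓ) (T : ℝ) (Rs : Set ℕ)
    (E : ℕ → ℝ) {r m : ℝ} (hr : 0 ≤ r) (hm : 0 < m) (hball : ENNReal.ofReal m ≤ haarProbability G {g : G | ‖ρ g - 1‖ ≤ r}) :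
    SupCellRarityAt ρ β w (WorkingClass ρ ℓ T Rs E w) (workingBudget N β r m b ℓ T E) := by
  have hw' : ∀ i j, w i j + ((b : ℕ) : ℤ) ≤ w i (j + 1) ∧ w i (j + 1) ≤ w i j + 2 * ((b : ℕ) : ℤ) := hw
  intro c ζ
  have h := supCellRarity_workingClass_of_ballBound ρ β hw' (ℓ := ℓ) (T := T) (Rs := Rs) (E := E)
    (δdil := (2 * b : ℝ) ^ 4 * (Real.exp (β * (48 * r ^ 2 * (ℓ : ℝ) ^ 4 + 192 * N * (ℓ : ℝ) ^ 3) - β * T) /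
      m ^ (4 * ℓ ^ 4))) (by positivity) (η := fun R => ballBudget N β r m R (E R))
    (fun R => ballBudget_nonneg N β r hm R (E R))
    (fun c' ζ' => supCellRarity_diluteTyp ρ hρ hU hβ hw' hℓ hm hball T c' ζ')
    (fun c' R x _ hint ζ' => kernel_badBall_le ρ hρ hU hβ hint
      (by rw [← regionEdges_singleton w c']) ζ' (E R) hr hm hball) c ζ
  simpa [workingBudget] using h

end Working

end Summit.QuantumFields.YangMills.Cruxes.IR.AfPincerUc.Supplier

end
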